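import Mathlib
import Summits.Ventures.PercRepro2.CoinChainXATopGate
import Summits.Ventures.PercRepro2.CoinChainXATopGateFullAlg

/-!
# The TOP gate of the (j, j′) pair — the surviving-vs-sure-entered facts
(blind cell PercRepro2, night-2 g30; §72.11)

The facts of the parts model that need `d` LOG-SUPERMODULAR (`hdd`): the coin-SURVIVING law `νd` on
the coin-entered clusters missing `ent` is Holley-below the law `νd` on the sure-entered clusters —
the meet of a surviving cluster and a sure-entered one misses `ent`, their join is sure-entered, and
`ν s·ν t ≤ ν(s∩t)·ν(s∪t)`, `d s·d t ≤ d(s∩t)·d(s∪t)` with increasing markers.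
-/

namespace Summit.Ventures.PercRepro2.Coin

open Classical

section BBFacts

variable {V : Type*} [DecidableEq V] {R : Type*} [Field R] [LinearOrder R] [IsStrictOrderedRing R]
variable (U ent ent' : Finset V) (ν d : Finset V → R)
variable (hν0 : ∀ W, 0 ≤ ν W) (hν : ∀ s ⊆ U, ∀ t ⊆ U, ν s * ν t ≤ ν (s ∩ t) * ν (s ∪ t))
  (hd0 : ∀ W, 0 ≤ d W) (hdd : ∀ s t, d s * d t ≤ d (s ∩ t) * d (s ∪ t))

include hν0 hν hd0 hdd in
/-- **The coin-surviving clusters are Holley-below the sure-entered ones** (`BB_x`): the `x`-mass of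
`νd` on the coin-entered clusters missing `ent` times the `νd`-mass of the sure-entered clusters is at
most the `νd`-mass of the clusters missing `ent` times the `x`-mass of `νd` on the sure-entered ones. -/
theorem cg_fact_BB (x : Finset V → R) (hx0 : ∀ W, 0 ≤ x W) (hxm : ∀ s t, x s ≤ x (s ∪ t)) :
    (∑ W ∈ U.powerset.filter (fun W => (¬ ∃ r ∈ ent, r ∈ W) ∧ ∃ r ∈ ent', r ∈ W), ν W * d W * x W)
      * (∑ W ∈ U.powerset.filter (fun W => ∃ r ∈ ent, r ∈ W), ν W * d W) ≤
    (∑ W ∈ U.powerset.filter (fun W => ¬ ∃ r ∈ ent, r ∈ W), ν W * d W)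
      * (∑ W ∈ U.powerset.filter (fun W => ∃ r ∈ ent, r ∈ W), ν W * d W * x W) := by
  refine ad_sets_dec U (fun W => ν W * d W * x W) (fun W => ν W * d W)
    (fun W => ν W * d W) (fun W => ν W * d W * x W)
    (fun W => mul_nonneg (mul_nonneg (hν0 W) (hd0 W)) (hx0 W)) (fun W => mul_nonneg (hν0 W) (hd0 W))
    (fun W => mul_nonneg (hν0 W) (hd0 W)) (fun W => mul_nonneg (mul_nonneg (hν0 W) (hd0 W)) (hx0 W))
    (fun W => (¬ ∃ r ∈ ent, r ∈ W) ∧ ∃ r ∈ ent', r ∈ W) (fun W => ∃ r ∈ ent, r ∈ W)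
    (fun W => ¬ ∃ r ∈ ent, r ∈ W) (fun W => ∃ r ∈ ent, r ∈ W) ?_
  intro s hs t ht hA hB
  refine ⟨fun ⟨r, hr, hrW⟩ => hA.1 ⟨r, hr, (Finset.mem_inter.1 hrW).1⟩, ?_, ?_⟩
  · obtain ⟨r, hr, hrt⟩ := hB
    exact ⟨r, hr, Finset.mem_union.2 (Or.inr hrt)⟩
  · calc ν s * d s * x s * (ν t * d t) = ((ν s * ν t) * (d s * d t)) * x s := by ring
      _ ≤ ((ν (s ∩ t) * ν (s ∪ t)) * (d (s ∩ t) * d (s ∪ t))) * x (s ∪ t) :=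
          mul_le_mul (mul_le_mul (hν s hs t ht) (hdd s t) (mul_nonneg (hd0 s) (hd0 t))
            (mul_nonneg (hν0 _) (hν0 _))) (hxm s t) (hx0 s)
            (mul_nonneg (mul_nonneg (hν0 _) (hν0 _)) (mul_nonneg (hd0 _) (hd0 _)))
      _ = ν (s ∩ t) * d (s ∩ t) * (ν (s ∪ t) * d (s ∪ t) * x (s ∪ t)) := by ring

include hν0 hν hd0 hdd in
/-- **The surviving `x`-marked clusters against the sure-entered `y`-marked ones** (`BB_xy`): the join
carries both markers. -/
theorem cg_fact_BB2 (x y : Finset V → R) (hx0 : ∀ W, 0 ≤ x W) (hy0 : ∀ W, 0 ≤ y W)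
    (hxm : ∀ s t, x s ≤ x (s ∪ t)) (hym : ∀ s t, y s ≤ y (s ∪ t)) :
    (∑ W ∈ U.powerset.filter (fun W => (¬ ∃ r ∈ ent, r ∈ W) ∧ ∃ r ∈ ent', r ∈ W), ν W * d W * x W)
      * (∑ W ∈ U.powerset.filter (fun W => ∃ r ∈ ent, r ∈ W), ν W * d W * y W) ≤
    (∑ W ∈ U.powerset.filter (fun W => ¬ ∃ r ∈ ent, r ∈ W), ν W * d W)
      * (∑ W ∈ U.powerset.filter (fun W => ∃ r ∈ ent, r ∈ W), ν W * d W * (x W * y W)) := by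
  refine ad_sets_dec U (fun W => ν W * d W * x W) (fun W => ν W * d W * y W)
    (fun W => ν W * d W) (fun W => ν W * d W * (x W * y W))
    (fun W => mul_nonneg (mul_nonneg (hν0 W) (hd0 W)) (hx0 W))
    (fun W => mul_nonneg (mul_nonneg (hν0 W) (hd0 W)) (hy0 W))
    (fun W => mul_nonneg (hν0 W) (hd0 W))
    (fun W => mul_nonneg (mul_nonneg (hν0 W) (hd0 W)) (mul_nonneg (hx0 W) (hy0 W)))
    (fun W => (¬ ∃ r ∈ ent, r ∈ W) ∧ ∃ r ∈ ent', r ∈ W) (fun W => ∃ r ∈ ent, r ∈ W)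
    (fun W => ¬ ∃ r ∈ ent, r ∈ W) (fun W => ∃ r ∈ ent, r ∈ W) ?_
  intro s hs t ht hA hB
  refine ⟨fun ⟨r, hr, hrW⟩ => hA.1 ⟨r, hr, (Finset.mem_inter.1 hrW).1⟩, ?_, ?_⟩
  · obtain ⟨r, hr, hrt⟩ := hB
    exact ⟨r, hr, Finset.mem_union.2 (Or.inr hrt)⟩
  · have hyt : y t ≤ y (s ∪ t) := by rw [Finset.union_comm]; exact hym t s
    calc ν s * d s * x s * (ν t * d t * y t) = ((ν s * ν t) * (d s * d t)) * (x s * y t) := by ring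
      _ ≤ ((ν (s ∩ t) * ν (s ∪ t)) * (d (s ∩ t) * d (s ∪ t))) * (x (s ∪ t) * y (s ∪ t)) :=
          mul_le_mul (mul_le_mul (hν s hs t ht) (hdd s t) (mul_nonneg (hd0 s) (hd0 t))
            (mul_nonneg (hν0 _) (hν0 _)))
            (mul_le_mul (hxm s t) hyt (hy0 t) (hx0 _)) (mul_nonneg (hx0 s) (hy0 t))
            (mul_nonneg (mul_nonneg (hν0 _) (hν0 _)) (mul_nonneg (hd0 _) (hd0 _)))
      _ = ν (s ∩ t) * d (s ∩ t) * (ν (s ∪ t) * d (s ∪ t) * (x (s ∪ t) * y (s ∪ t))) := by ring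

end BBFacts

section TopGateFullMain

variable {V : Type*} [DecidableEq V] {R : Type*} [Field R] [LinearOrder R] [IsStrictOrderedRing R]

set_option maxHeartbeats 1600000 in
/-- **THE THREE-COIN TOP GATE IS A THEOREM OF THE CHAIN**: for `ent = {m}`, any `ent' ∋ j, j'`, the
entry markers `x = 1[j ∈ ·]`, `y = 1[j' ∈ ·]` and the top gate `d' = d·1[{m, j, j'} ⊆ W]`, the cleared
(XA′) `Cross ≤ a0·U001` — the hypothesis `hXA'` of `chain_functional_nonneg_of_XA'` — holds for every
`ν` log-supermodular and `0 ≤ d ≤ c` with `c`-`d` Holley (`hcd`), `d/c` increasing (`hratio`) and `d`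
log-supermodular (`hdd`): the region sums of `chain_XA'_top_of_a0`, its facts, the two
surviving-vs-sure-entered facts `cg_fact_BB` and the 83-term certificate `cg_top_full`. -/
theorem chain_XA'_top_gate (U : Finset V) (m j j' : V) (ent' : Finset V) (ν c d : Finset V → R)
    (hj : j ∈ ent') (hj' : j' ∈ ent')
    (hν0 : ∀ W, 0 ≤ ν W) (hν : ∀ s ⊆ U, ∀ t ⊆ U, ν s * ν t ≤ ν (s ∩ t) * ν (s ∪ t))
    (hc0 : ∀ W, 0 ≤ c W) (hd0 : ∀ W, 0 ≤ d W) (hdc : ∀ W, d W ≤ c W)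
    (hcd : ∀ s t, c s * d t ≤ c (s ∩ t) * d (s ∪ t))
    (hratio : ∀ s t, s ⊆ t → d s * c t ≤ c s * d t)
    (hdd : ∀ s t, d s * d t ≤ d (s ∩ t) * d (s ∪ t))
    (x y : Finset V → R) (hx : ∀ W, x W = if j ∈ W then 1 else 0) (hy : ∀ W, y W = if j' ∈ W then 1 else 0) :
    (((∑ W ∈ U.powerset, ν W * chainMix {m} ent' 0 c d W) * (∑ W ∈ U.powerset, ν W * chainMix {m} ent' 1 c d W * x W) - (∑ W ∈ U.powerset, ν W * chainMix {m} ent' 0 c d W * x W) * (∑ W ∈ U.powerset, ν W * chainMix {m} ent' 1 c d W)) *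
          ((∑ W ∈ U.powerset, ν W * chainMix {m} ent' 0 c d W) * (∑ W ∈ U.powerset, ν W * chainMix {m} ent' 0 c (fun W => if m ∈ W ∧ j ∈ W ∧ j' ∈ W then d W else 0) W * y W) - (∑ W ∈ U.powerset, ν W * chainMix {m} ent' 0 c d W * y W) * (∑ W ∈ U.powerset, ν W * chainMix {m} ent' 0 c (fun W => if m ∈ W ∧ j ∈ W ∧ j' ∈ W then d W else 0) W))
        + ((∑ W ∈ U.powerset, ν W * chainMix {m} ent' 0 c d W) * (∑ W ∈ U.powerset, ν W * chainMix {m} ent' 1 c d W * y W) - (∑ W ∈ U.powerset, ν W * chainMix {m} ent' 0 c d W * y W) * (∑ W ∈ U.powerset, ν W * chainMix {m} ent' 1 c d W)) *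
          ((∑ W ∈ U.powerset, ν W * chainMix {m} ent' 0 c d W) * (∑ W ∈ U.powerset, ν W * chainMix {m} ent' 0 c (fun W => if m ∈ W ∧ j ∈ W ∧ j' ∈ W then d W else 0) W * x W) - (∑ W ∈ U.powerset, ν W * chainMix {m} ent' 0 c d W * x W) * (∑ W ∈ U.powerset, ν W * chainMix {m} ent' 0 c (fun W => if m ∈ W ∧ j ∈ W ∧ j' ∈ W then d W else 0) W))) ≤
        (∑ W ∈ U.powerset, ν W * chainMix {m} ent' 0 c d W) * ((∑ W ∈ U.powerset, ν W * chainMix {m} ent' 0 c d W) * (∑ W ∈ U.powerset, ν W * chainMix {m} ent' 0 c d W) * (∑ W ∈ U.powerset, ν W * chainMix {m} ent' 1 c (fun W => if m ∈ W ∧ j ∈ W ∧ j' ∈ W then d W else 0) W * (x W * y W))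
          - (∑ W ∈ U.powerset, ν W * chainMix {m} ent' 0 c d W) * (∑ W ∈ U.powerset, ν W * chainMix {m} ent' 0 c d W * y W) * (∑ W ∈ U.powerset, ν W * chainMix {m} ent' 1 c (fun W => if m ∈ W ∧ j ∈ W ∧ j' ∈ W then d W else 0) W * x W)
          - (∑ W ∈ U.powerset, ν W * chainMix {m} ent' 0 c d W) * (∑ W ∈ U.powerset, ν W * chainMix {m} ent' 0 c d W * x W) * (∑ W ∈ U.powerset, ν W * chainMix {m} ent' 1 c (fun W => if m ∈ W ∧ j ∈ W ∧ j' ∈ W then d W else 0) W * y W)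
          + (∑ W ∈ U.powerset, ν W * chainMix {m} ent' 0 c d W * x W) * (∑ W ∈ U.powerset, ν W * chainMix {m} ent' 0 c d W * y W) * (∑ W ∈ U.powerset, ν W * chainMix {m} ent' 1 c (fun W => if m ∈ W ∧ j ∈ W ∧ j' ∈ W then d W else 0) W)) := by
  -- the markers
  have hx0 : ∀ W, 0 ≤ x W := fun W => by rw [hx W]; split_ifs <;> norm_num
  have hy0 : ∀ W, 0 ≤ y W := fun W => by rw [hy W]; split_ifs <;> norm_num
  have hx1 : ∀ W, x W ≤ 1 := fun W => by rw [hx W]; split_ifs <;> norm_num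
  have hy1 : ∀ W, y W ≤ 1 := fun W => by rw [hy W]; split_ifs <;> norm_num
  have hxm : ∀ s t, x s ≤ x (s ∪ t) := fun s t => by
    rw [hx s, hx (s ∪ t)]
    by_cases h : j ∈ s
    · rw [if_pos h, if_pos (Finset.mem_union_left t h)]
    · rw [if_neg h]; split_ifs <;> norm_num
  have hym : ∀ s t, y s ≤ y (s ∪ t) := fun s t => by
    rw [hy s, hy (s ∪ t)]
    by_cases h : j' ∈ s
    · rw [if_pos h, if_pos (Finset.mem_union_left t h)]
    · rw [if_neg h]; split_ifs <;> norm_num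
  have hxI : ∀ W, (¬ ∃ r ∈ ({m} : Finset V) ∪ ent', r ∈ W) → x W = 0 := fun W hW => by
    rw [hx W]; exact if_neg (fun h => hW ⟨j, Finset.mem_union.2 (Or.inr hj), h⟩)
  have hyI : ∀ W, (¬ ∃ r ∈ ({m} : Finset V) ∪ ent', r ∈ W) → y W = 0 := fun W hW => by
    rw [hy W]; exact if_neg (fun h => hW ⟨j', Finset.mem_union.2 (Or.inr hj'), h⟩)
  have hxT : ∀ W, (m ∈ W ∧ j ∈ W ∧ j' ∈ W) → x W = 1 := fun W hW => by rw [hx W]; exact if_pos hW.2.1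
  have hyT : ∀ W, (m ∈ W ∧ j ∈ W ∧ j' ∈ W) → y W = 1 := fun W hW => by rw [hy W]; exact if_pos hW.2.2
  have hxyT : ∀ W, (m ∈ W ∧ j ∈ W ∧ j' ∈ W) → x W * y W = 1 := fun W hW => by
    rw [hxT W hW, hyT W hW, mul_one]
  -- the thirteen moments
  have hxy := cg_top_g U m j j' ent' ν c d (fun W => x W * y W)
  rw [cg_a0 U {m} ent' ν c d, cg_mom0 U {m} ent' ν c d x, cg_mom0 U {m} ent' ν c d y,
    cg_b0 U {m} ent' ν c d, cg_mom1 U {m} ent' ν c d x, cg_mom1 U {m} ent' ν c d y,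
    cg_top_e0 U m j j' ent' ν c d, cg_top_e U m j j' ent' ν c d x, cg_top_e U m j j' ent' ν c d y,
    cg_top_g0 U m j j' ent' ν c d, cg_top_g U m j j' ent' ν c d x, cg_top_g U m j j' ent' ν c d y, hxy,
    sum_M_split_top U m j j' (fun W => ν W * d W), sum_M_split_top U m j j' (fun W => ν W * d W * x W),
    sum_M_split_top U m j j' (fun W => ν W * d W * y W)]
  have hIx : (∑ W ∈ U.powerset.filter (fun W => ¬ ∃ r ∈ ({m} : Finset V) ∪ ent', r ∈ W), ν W * c W * x W) = 0 := cgate_sum_zero U _ _ (fun W hW => by rw [hxI W hW, mul_zero])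
  have hIy : (∑ W ∈ U.powerset.filter (fun W => ¬ ∃ r ∈ ({m} : Finset V) ∪ ent', r ∈ W), ν W * c W * y W) = 0 := cgate_sum_zero U _ _ (fun W hW => by rw [hyI W hW, mul_zero])
  have hIxy : (∑ W ∈ U.powerset.filter (fun W => ¬ ∃ r ∈ ({m} : Finset V) ∪ ent', r ∈ W), ν W * c W * (x W * y W)) = 0 :=
    cgate_sum_zero U _ _ (fun W hW => by rw [hxI W hW, zero_mul, mul_zero])
  rw [hIx, hIy, hIxy, cg_sum_weight_one U _ (fun W => ν W * d W) x hxT, cg_sum_weight_one U _ (fun W => ν W * d W) y hyT,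
    cg_sum_weight_one U _ (fun W => ν W * d W) (fun W => x W * y W) hxyT,
    cg_split' U ν c d (fun W => (¬ ∃ r ∈ ({m} : Finset V), r ∈ W) ∧ ∃ r ∈ ent', r ∈ W), cg_split U ν c d (fun W => (¬ ∃ r ∈ ({m} : Finset V), r ∈ W) ∧ ∃ r ∈ ent', r ∈ W) x, cg_split U ν c d (fun W => (¬ ∃ r ∈ ({m} : Finset V), r ∈ W) ∧ ∃ r ∈ ent', r ∈ W) y]
  -- the part sums
  set a := (∑ W ∈ U.powerset.filter (fun W => ¬ ∃ r ∈ ({m} : Finset V) ∪ ent', r ∈ W), ν W * c W) with ha_def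
  set δ := (∑ W ∈ U.powerset.filter (fun W => (¬ ∃ r ∈ ({m} : Finset V), r ∈ W) ∧ ∃ r ∈ ent', r ∈ W), ν W * (c W - d W)) with hδ_def
  set u := (∑ W ∈ U.powerset.filter (fun W => (¬ ∃ r ∈ ({m} : Finset V), r ∈ W) ∧ ∃ r ∈ ent', r ∈ W), ν W * d W) with hu_def
  set ω := (∑ W ∈ U.powerset.filter (fun W => m ∈ W ∧ j ∈ W ∧ j' ∈ W), ν W * d W) with hω_def
  set tR := (∑ W ∈ U.powerset.filter (fun W => m ∈ W ∧ ¬ (j ∈ W ∧ j' ∈ W)), ν W * d W) with htR_def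
  set XJ := (∑ W ∈ U.powerset.filter (fun W => (¬ ∃ r ∈ ({m} : Finset V), r ∈ W) ∧ ∃ r ∈ ent', r ∈ W), ν W * (c W - d W) * x W) with hXJ_def
  set XU := (∑ W ∈ U.powerset.filter (fun W => (¬ ∃ r ∈ ({m} : Finset V), r ∈ W) ∧ ∃ r ∈ ent', r ∈ W), ν W * d W * x W) with hXU_def
  set XR := (∑ W ∈ U.powerset.filter (fun W => m ∈ W ∧ ¬ (j ∈ W ∧ j' ∈ W)), ν W * d W * x W) with hXR_def
  set YJ := (∑ W ∈ U.powerset.filter (fun W => (¬ ∃ r ∈ ({m} : Finset V), r ∈ W) ∧ ∃ r ∈ ent', r ∈ W), ν W * (c W - d W) * y W) with hYJ_def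
  set YU := (∑ W ∈ U.powerset.filter (fun W => (¬ ∃ r ∈ ({m} : Finset V), r ∈ W) ∧ ∃ r ∈ ent', r ∈ W), ν W * d W * y W) with hYU_def
  set YR := (∑ W ∈ U.powerset.filter (fun W => m ∈ W ∧ ¬ (j ∈ W ∧ j' ∈ W)), ν W * d W * y W) with hYR_def
  have hcd0 : ∀ W, 0 ≤ c W - d W := fun W => by linarith [hdc W]
  have ha : 0 ≤ a := Finset.sum_nonneg (fun W _ => mul_nonneg (hν0 W) (hc0 W))
  have hδ : 0 ≤ δ := Finset.sum_nonneg (fun W _ => mul_nonneg (hν0 W) (hcd0 W))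
  have hu : 0 ≤ u := Finset.sum_nonneg (fun W _ => mul_nonneg (hν0 W) (hd0 W))
  have hω : 0 ≤ ω := Finset.sum_nonneg (fun W _ => mul_nonneg (hν0 W) (hd0 W))
  have htR : 0 ≤ tR := Finset.sum_nonneg (fun W _ => mul_nonneg (hν0 W) (hd0 W))
  have hXJ : 0 ≤ XJ := Finset.sum_nonneg (fun W _ => mul_nonneg (mul_nonneg (hν0 W) (hcd0 W)) (hx0 W))
  have hXU : 0 ≤ XU := Finset.sum_nonneg (fun W _ => mul_nonneg (mul_nonneg (hν0 W) (hd0 W)) (hx0 W))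
  have hXR : 0 ≤ XR := Finset.sum_nonneg (fun W _ => mul_nonneg (mul_nonneg (hν0 W) (hd0 W)) (hx0 W))
  have hYJ : 0 ≤ YJ := Finset.sum_nonneg (fun W _ => mul_nonneg (mul_nonneg (hν0 W) (hcd0 W)) (hy0 W))
  have hYU : 0 ≤ YU := Finset.sum_nonneg (fun W _ => mul_nonneg (mul_nonneg (hν0 W) (hd0 W)) (hy0 W))
  have hYR : 0 ≤ YR := Finset.sum_nonneg (fun W _ => mul_nonneg (mul_nonneg (hν0 W) (hd0 W)) (hy0 W))
  have hXJδ : XJ ≤ δ := Finset.sum_le_sum (fun W _ => mul_le_of_le_one_right (mul_nonneg (hν0 W) (hcd0 W)) (hx1 W))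
  have hXUu : XU ≤ u := Finset.sum_le_sum (fun W _ => mul_le_of_le_one_right (mul_nonneg (hν0 W) (hd0 W)) (hx1 W))
  have hXRt : XR ≤ tR := Finset.sum_le_sum (fun W _ => mul_le_of_le_one_right (mul_nonneg (hν0 W) (hd0 W)) (hx1 W))
  have hYJδ : YJ ≤ δ := Finset.sum_le_sum (fun W _ => mul_le_of_le_one_right (mul_nonneg (hν0 W) (hcd0 W)) (hy1 W))
  have hYUu : YU ≤ u := Finset.sum_le_sum (fun W _ => mul_le_of_le_one_right (mul_nonneg (hν0 W) (hd0 W)) (hy1 W))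
  have hYRt : YR ≤ tR := Finset.sum_le_sum (fun W _ => mul_le_of_le_one_right (mul_nonneg (hν0 W) (hd0 W)) (hy1 W))
  -- the Holley facts
  have FJUx := cg_fact_JU' U {m} ent' ν c d hν0 hν hc0 hd0 hdc hcd hratio x hx0 hxm
  have FJMx := cg_fact_JM' U {m} ent' ν c d hν0 hν hc0 hd0 hdc hcd hratio x hx0 hxm
  have FJUy := cg_fact_JU' U {m} ent' ν c d hν0 hν hc0 hd0 hdc hcd hratio y hy0 hym
  have FMx := cg_fact_McM U {m} ent' ν c d hν0 hν hc0 hd0 hcd x hx0 hxm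
  have FMy := cg_fact_McM U {m} ent' ν c d hν0 hν hc0 hd0 hcd y hy0 hym
  rw [cg_entfree_piecewise U {m} ent' ν c d x, cg_entfree_piecewise' U {m} ent' ν c d, hIx, zero_add] at FJUx FJMx
  rw [cg_entfree_piecewise U {m} ent' ν c d y, cg_entfree_piecewise' U {m} ent' ν c d, hIy, zero_add] at FJUy
  rw [sum_M_split_top U m j j' (fun W => ν W * d W), sum_M_split_top U m j j' (fun W => ν W * d W * x W),
    cg_sum_weight_one U _ (fun W => ν W * d W) x hxT] at FJMx
  rw [sum_entfree_split U {m} ent' (fun W => ν W * c W), cg_split' U ν c d (fun W => (¬ ∃ r ∈ ({m} : Finset V), r ∈ W) ∧ ∃ r ∈ ent', r ∈ W), cg_split U ν c d (fun W => (¬ ∃ r ∈ ({m} : Finset V), r ∈ W) ∧ ∃ r ∈ ent', r ∈ W) x,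
    sum_M_split_top U m j j' (fun W => ν W * d W), sum_M_split_top U m j j' (fun W => ν W * d W * x W),
    cg_sum_weight_one U _ (fun W => ν W * d W) x hxT] at FMx
  rw [sum_entfree_split U {m} ent' (fun W => ν W * c W), cg_split' U ν c d (fun W => (¬ ∃ r ∈ ({m} : Finset V), r ∈ W) ∧ ∃ r ∈ ent', r ∈ W), cg_split U ν c d (fun W => (¬ ∃ r ∈ ({m} : Finset V), r ∈ W) ∧ ∃ r ∈ ent', r ∈ W) y,
    sum_M_split_top U m j j' (fun W => ν W * d W), sum_M_split_top U m j j' (fun W => ν W * d W * y W),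
    cg_sum_weight_one U _ (fun W => ν W * d W) y hyT] at FMy
  -- the killed-vs-gate facts
  have FIMx := cg_fact_IMk U m j j' ent' ν c d hν0 hν hc0 hd0 hdc hcd hratio x hx
  have FIMy := cg_fact_IMk' U m j j' ent' ν c d hν0 hν hc0 hd0 hdc hcd hratio y hy
  have eXJ : XJ = (∑ W ∈ U.powerset.filter (fun W => ((¬ ∃ r ∈ ({m} : Finset V), r ∈ W) ∧ ∃ r ∈ ent', r ∈ W) ∧ j ∈ W), ν W * (c W - d W)) := cg_sum_marker U _ (fun W => ν W * (c W - d W)) x j hx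
  have eYJ : YJ = (∑ W ∈ U.powerset.filter (fun W => ((¬ ∃ r ∈ ({m} : Finset V), r ∈ W) ∧ ∃ r ∈ ent', r ∈ W) ∧ j' ∈ W), ν W * (c W - d W)) := cg_sum_marker U _ (fun W => ν W * (c W - d W)) y j' hy
  have eYR : YR = (∑ W ∈ U.powerset.filter (fun W => (m ∈ W ∧ ¬ (j ∈ W ∧ j' ∈ W)) ∧ j' ∈ W), ν W * d W) := cg_sum_marker U _ (fun W => ν W * d W) y j' hy
  have eXR : XR = (∑ W ∈ U.powerset.filter (fun W => (m ∈ W ∧ ¬ (j ∈ W ∧ j' ∈ W)) ∧ j ∈ W), ν W * d W) := cg_sum_marker U _ (fun W => ν W * d W) x j hx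
  have ePx : (∑ W ∈ U.powerset.filter (fun W => ¬ ∃ r ∈ ({m} : Finset V), r ∈ W), ν W * (if ∃ r ∈ ent', r ∈ W then c W - d W else c W) * (1 - x W)) = a + δ - XJ := by
    have h1 : (∑ W ∈ U.powerset.filter (fun W => ¬ ∃ r ∈ ({m} : Finset V), r ∈ W), ν W * (if ∃ r ∈ ent', r ∈ W then c W - d W else c W) * (1 - x W)) =
        (∑ W ∈ U.powerset.filter (fun W => ¬ ∃ r ∈ ({m} : Finset V), r ∈ W), ν W * (if ∃ r ∈ ent', r ∈ W then c W - d W else c W)) - (∑ W ∈ U.powerset.filter (fun W => ¬ ∃ r ∈ ({m} : Finset V), r ∈ W), ν W * (if ∃ r ∈ ent', r ∈ W then c W - d W else c W) * x W) := by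
      rw [← Finset.sum_sub_distrib]; exact Finset.sum_congr rfl (fun W _ => by ring)
    rw [h1, cg_entfree_piecewise U {m} ent' ν c d x, cg_entfree_piecewise' U {m} ent' ν c d, hIx]; ring
  have ePy : (∑ W ∈ U.powerset.filter (fun W => ¬ ∃ r ∈ ({m} : Finset V), r ∈ W), ν W * (if ∃ r ∈ ent', r ∈ W then c W - d W else c W) * (1 - y W)) = a + δ - YJ := by
    have h1 : (∑ W ∈ U.powerset.filter (fun W => ¬ ∃ r ∈ ({m} : Finset V), r ∈ W), ν W * (if ∃ r ∈ ent', r ∈ W then c W - d W else c W) * (1 - y W)) =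
        (∑ W ∈ U.powerset.filter (fun W => ¬ ∃ r ∈ ({m} : Finset V), r ∈ W), ν W * (if ∃ r ∈ ent', r ∈ W then c W - d W else c W)) - (∑ W ∈ U.powerset.filter (fun W => ¬ ∃ r ∈ ({m} : Finset V), r ∈ W), ν W * (if ∃ r ∈ ent', r ∈ W then c W - d W else c W) * y W) := by
      rw [← Finset.sum_sub_distrib]; exact Finset.sum_congr rfl (fun W _ => by ring)
    rw [h1, cg_entfree_piecewise U {m} ent' ν c d y, cg_entfree_piecewise' U {m} ent' ν c d, hIy]; ring
  rw [← eXJ, ← eYR, ePx] at FIMx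
  rw [← eYJ, ← eXR, ePy] at FIMy
  -- the parts inequality at the top gate
  -- the surviving-vs-sure-entered facts (these need `d` log-supermodular)
  have FBx := cg_fact_BB U {m} ent' ν d hν0 hν hd0 hdd x hx0 hxm
  have FBy := cg_fact_BB U {m} ent' ν d hν0 hν hd0 hdd y hy0 hym
  rw [sum_entfree_split U {m} ent' (fun W => ν W * d W),
    sum_M_split_top U m j j' (fun W => ν W * d W), sum_M_split_top U m j j' (fun W => ν W * d W * x W),
    cg_sum_weight_one U _ (fun W => ν W * d W) x hxT] at FBx
  rw [sum_entfree_split U {m} ent' (fun W => ν W * d W),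
    sum_M_split_top U m j j' (fun W => ν W * d W), sum_M_split_top U m j j' (fun W => ν W * d W * y W),
    cg_sum_weight_one U _ (fun W => ν W * d W) y hyT] at FBy
  have hBI : (∑ W ∈ U.powerset.filter (fun W => ¬ ∃ r ∈ ({m} : Finset V) ∪ ent', r ∈ W), ν W * d W) ≤ a :=
    Finset.sum_le_sum (fun W _ => mul_le_mul_of_nonneg_left (hdc W) (hν0 W))
  have hBI0 : 0 ≤ (∑ W ∈ U.powerset.filter (fun W => ¬ ∃ r ∈ ({m} : Finset V) ∪ ent', r ∈ W), ν W * d W) :=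
    Finset.sum_nonneg (fun W _ => mul_nonneg (hν0 W) (hd0 W))
  have hBx : 0 ≤ (ω + XR) * (a + u) - XU * (ω + tR) := by
    nlinarith [FBx, mul_le_mul_of_nonneg_right hBI (add_nonneg hω hXR)]
  have hBy : 0 ≤ (ω + YR) * (a + u) - YU * (ω + tR) := by
    nlinarith [FBy, mul_le_mul_of_nonneg_right hBI (add_nonneg hω hYR)]
  -- the parts inequality at the top gate, at the true ideal mass
  have key := cg_top_full a δ u (ω + tR) XJ XU (ω + XR) YJ YU (ω + YR) ω ha hδ hu (by linarith) hXJ hXU (by linarith)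
    hYJ hYU (by linarith) hω (by linear_combination FJUx) (by linear_combination FJMx) (by linear_combination FMx)
    (by linear_combination FJUy) (by linear_combination FMy) (by linear_combination FIMx) (by linear_combination FIMy)
    hBx hBy
    (by linarith) (by linarith) (by linarith) (by linarith) (by linarith) (by linarith) (by linarith) (by linarith)
  linear_combination key

end TopGateFullMain

end Summit.Ventures.PercRepro2.Coin
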